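import Literature.NumberTheory.GaloisRepresentations.LocalWeilDatumDegree
import Literature.NumberTheory.GaloisRepresentations.LocalClassFieldAxiom
import Mathlib.RingTheory.Norm.Transitivity
import HarnessLib

/-!
# Unramified levels over a finite extension of a local field: degrees and norm groups

For a non-archimedean local field `F`, a finite separable `K ⊆ F̄` (`K ≤ sepClosure F`) with residue
degree `f_K` (`fDeg`), and `m ≥ 1` a multiple of `f_K`, the compositum `K_m = K F_m` with the
unramified level `F_m` of `F` (`LocalWeilDatum.unramifiedLevel`) is the unramified extension of `K`
of degree `m / f_K`.  Using the Weil group `W_F` and its degree map (`LocalWeilDatum*.lean`), and the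
arithmetic invariant `t_K(a) = ord_F(N_{K/F} a) ∈ f_K ℤ` (`tVal`; `t_K = f_K v_K`), we prove:

* `LocalWeilDatum.fieldSubgroup_unrLevel` — `W_{K_m} = W_K ∩ deg⁻¹(mℤ)`;
* `LocalWeilDatum.isGalois_unrLevel`, `isCyclic_gal_unrLevel` — `K_m/K` is cyclic Galois, generated
  by the Frobenius of `K` (`isGalois_of_le_normalizer`, `forall_mem_zpowers_relRestrict`);
* `LocalWeilDatum.relIndex_fieldSubgroup_unrLevel`, `finrank_unrLevel`, `fDeg_unrLevel` —
  `[K_m : K] = m / f_K` and `f_{K_m} = m`;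
* `LocalWeilDatum.range_unitsMap_norm_unrLevel` — **the norm group of `K_m/K` is
  `{a ∈ Kˣ : m ∣ t_K(a)}`** (`⊆` by transitivity of the norm and `f_{K_m} = m ∣ t_{K_m}`; equality by
  the norm index `(Kˣ : N K_mˣ) = [K_m : K]`, `cyclicNormIndexEq_holds`, both subgroups having index
  `m / f_K`); in particular **units (`t_K(a) = 0`) are norms from every `K_m`**
  (`exists_norm_eq_of_dvd_tVal`);
* `LocalWeilDatum.tVal_algebraMap`, `fDeg_dvd_finrank_mul_fDeg`, `exists_eq_mul_pow_of_tVal_eq` —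
  for `K ≤ L`: `t_L(a) = [L : K] t_K(a)`, `f_L ∣ [L : K] f_K`, and an element of `K` with
  `t_K = f_K` (a uniformiser) is `w · π_L^e` in `L` with `t_L(w) = 0`, `e f_L = [L : K] f_K`.

These are the field-theoretic inputs of the computation of the Brauer group of a local field by
unramified cyclic algebras (Serre, *Corps locaux* XIII §3–4).

## References
* J.-P. Serre, *Corps locaux*, Hermann, 1968, V §3, XIII §3–4. [SerreLocalFields1979]
* J. Neukirch, *Algebraic Number Theory*, Springer, 1999, Ch. IV §4, Ch. V §1. [NeukirchANT1999]
-/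

noncomputable section

open Field IsNonarchimedeanLocalField ValuativeRel IntermediateField

namespace Literature.NumberTheory.GaloisRepresentations

namespace LocalWeilDatum

open AbstractCFT GaloisRepresentations.IsNonarchimedeanLocalField

/-! ### Generalities -/

/-- Two subgroups `H ≤ K` with the same finite index are equal. [folklore] -/
theorem _root_.Subgroup.eq_of_le_of_index_eq {G : Type*} [Group G] {H K : Subgroup G} (h : H ≤ K)
    (hK : K.index ≠ 0) (hi : H.index = K.index) : H = K := by
  refine le_antisymm h (Subgroup.relIndex_eq_one.1 ?_)
  have h1 := Subgroup.relIndex_mul_index h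
  rw [hi] at h1
  exact (Nat.mul_eq_right hK).1 h1

/-- **The kernel of a homomorphism onto `Multiplicative (ℤ/d)` has index `d`.** [folklore] -/
theorem _root_.Subgroup.index_ker_of_surjective_zmod {G : Type*} [Group G] {d : ℕ} [NeZero d]
    (θ : G →* Multiplicative (ZMod d)) (hθ : Function.Surjective θ) : θ.ker.index = d := by
  rw [Subgroup.index_ker, MonoidHom.range_eq_top.2 hθ, Subgroup.card_top, Nat.card_eq_fintype_card,
    Fintype.card_multiplicative, ZMod.card]

section Local

variable (F : Type*) [Field F] [ValuativeRel F] [TopologicalSpace F] [IsNonarchimedeanLocalField F]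
variable (K : IntermediateField F (AlgebraicClosure F)) [FiniteDimensional F K]

/-! ### The residue degree `f_K` and the invariant `t_K = ord_F ∘ N_{K/F}` -/

/-- **The residue degree `f_K = [𝒪_K/𝔓_K : 𝓀_F]`** of the finite `K ⊆ F̄`. [cite: NeukirchANT1999, Ch. IV §4] -/
def fDeg : ℕ := Ideal.inertiaDeg' 𝓂[F] (primeOf F K)

/-- `0 < f_K`. [folklore] -/
theorem fDeg_pos : 0 < fDeg F K := by
  haveI := primeOf_liesOver F K
  haveI := module_finite_integralClosure F K
  exact Ideal.inertiaDeg'_pos 𝓂[F] (primeOf F K)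

/-- **`t_K(a) = ord_F (N_{K/F} a)`** (`= f_K v_K(a)`). [cite: SerreLocalFields1979, Ch. II §2 Cor. 3] -/
def tVal (a : K) : ℤ := ord F (Algebra.norm F a)

/-- `t_K` is additive on nonzero elements. [folklore] -/
theorem tVal_mul {a b : K} (ha : a ≠ 0) (hb : b ≠ 0) :
    tVal F K (a * b) = tVal F K a + tVal F K b := by
  unfold tVal
  rw [map_mul, ord_mul F (Algebra.norm_ne_zero_iff.2 ha) (Algebra.norm_ne_zero_iff.2 hb)]

omit [FiniteDimensional F K] in
/-- `t_K(1) = 0`. [folklore] -/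
theorem tVal_one : tVal F K 1 = 0 := by
  unfold tVal
  rw [map_one, ord_one]

/-- `t_K(a / b) = t_K(a) - t_K(b)`. [folklore] -/
theorem tVal_div {a b : K} (ha : a ≠ 0) (hb : b ≠ 0) :
    tVal F K (a / b) = tVal F K a - tVal F K b := by
  have h := tVal_mul F K (div_ne_zero ha hb) hb
  rw [div_mul_cancel₀ _ hb] at h
  linarith

/-- `t_K(a ^ n) = n t_K(a)`. [folklore] -/
theorem tVal_pow {a : K} (ha : a ≠ 0) (n : ℕ) : tVal F K (a ^ n) = n * tVal F K a := by
  unfold tVal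
  rw [map_pow, ord_pow F (Algebra.norm_ne_zero_iff.2 ha)]

/-- **`f_K ∣ t_K(a)`.** [cite: SerreLocalFields1979, Ch. II §2 Cor. 3] -/
theorem fDeg_dvd_tVal (hKs : K ≤ sepClosure F) {a : K} (ha : a ≠ 0) :
    (fDeg F K : ℤ) ∣ tVal F K a :=
  inertiaDeg_dvd_ord_norm F K hKs a ha

/-- **`t_K = f_K` is attained** (by a uniformiser of `K`). [cite: SerreLocalFields1979, Ch. II §2 Cor. 3] -/
theorem exists_tVal_eq_fDeg (hKs : K ≤ sepClosure F) : ∃ a : K, a ≠ 0 ∧ tVal F K a = fDeg F K := by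
  obtain ⟨a, ha, h⟩ := exists_ord_norm_eq_inertiaDeg F K hKs
  exact ⟨a, fun h0 => ha (Subtype.ext h0), h⟩

/-- The subgroup `{u ∈ Kˣ : m ∣ t_K(u)}`. [folklore] -/
def tDvd (m : ℕ) : Subgroup Kˣ where
  carrier := {u | (m : ℤ) ∣ tVal F K (u : K)}
  mul_mem' {a b} ha hb := by
    change (m : ℤ) ∣ tVal F K ((a * b : Kˣ) : K)
    rw [Units.val_mul, tVal_mul F K a.ne_zero b.ne_zero]
    exact dvd_add ha hb
  one_mem' := by
    change (m : ℤ) ∣ tVal F K ((1 : Kˣ) : K)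
    rw [Units.val_one, tVal_one]
    exact dvd_zero _
  inv_mem' {a} ha := by
    change (m : ℤ) ∣ tVal F K ((a⁻¹ : Kˣ) : K)
    rw [Units.val_inv_eq_inv_val, inv_eq_one_div, tVal_div F K one_ne_zero a.ne_zero, tVal_one,
      zero_sub, dvd_neg]
    exact ha

/-- Membership in `tDvd`. [folklore] -/
@[simp] theorem mem_tDvd_iff {m : ℕ} {u : Kˣ} : u ∈ tDvd F K m ↔ (m : ℤ) ∣ tVal F K (u : K) :=
  Iff.rfl

/-- **`{u : m ∣ t_K(u)}` has index `m / f_K` in `Kˣ`** for `f_K ∣ m`, `0 < m`: it is the kernel of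
`u ↦ t_K(u)/f_K (mod m/f_K)`, which is onto. [folklore] -/
theorem index_tDvd (hKs : K ≤ sepClosure F) {m : ℕ} (hm : 0 < m) (hfm : fDeg F K ∣ m) :
    (tDvd F K m).index = m / fDeg F K := by
  obtain ⟨d, hd⟩ := hfm
  have hf := fDeg_pos F K
  have hd0 : 0 < d := Nat.pos_of_mul_pos_left (hd ▸ hm)
  haveI : NeZero d := ⟨hd0.ne'⟩
  have hdiv : m / fDeg F K = d := by rw [hd, Nat.mul_div_cancel_left _ hf]
  -- the homomorphism `u ↦ t(u)/f mod d`
  let θ : Kˣ →* Multiplicative (ZMod d) :=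
    { toFun := fun u => Multiplicative.ofAdd (((tVal F K (u : K) / fDeg F K : ℤ) : ZMod d))
      map_one' := by
        rw [Units.val_one, tVal_one, Int.zero_ediv, Int.cast_zero]
        rfl
      map_mul' := fun a b => by
        rw [← ofAdd_add, ← Int.cast_add, Units.val_mul, tVal_mul F K a.ne_zero b.ne_zero,
          Int.add_ediv_of_dvd_left (fDeg_dvd_tVal F K hKs a.ne_zero)] }
  have hker : θ.ker = tDvd F K m := by
    ext u
    rw [MonoidHom.mem_ker, mem_tDvd_iff]
    change Multiplicative.ofAdd _ = Multiplicative.ofAdd 0 ↔ _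
    rw [Multiplicative.ofAdd.injective.eq_iff, ZMod.intCast_zmod_eq_zero_iff_dvd]
    obtain ⟨c, hc⟩ := fDeg_dvd_tVal F K hKs u.ne_zero
    rw [hc, Int.mul_ediv_cancel_left _ (by exact_mod_cast hf.ne'), hd, Nat.cast_mul]
    exact (mul_dvd_mul_iff_left (by exact_mod_cast hf.ne')).symm
  have hsurj : Function.Surjective θ := by
    obtain ⟨a, ha, hta⟩ := exists_tVal_eq_fDeg F K hKs
    intro x
    refine ⟨Units.mk0 a ha ^ (Multiplicative.toAdd x).val, ?_⟩
    rw [map_pow]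
    change Multiplicative.ofAdd (((tVal F K a / fDeg F K : ℤ) : ZMod d)) ^ _ = x
    rw [hta, Int.ediv_self (by exact_mod_cast hf.ne'), Int.cast_one, ← ofAdd_nsmul, nsmul_one,
      ZMod.natCast_zmod_val]
    rfl
  rw [← hker, hdiv]
  exact Subgroup.index_ker_of_surjective_zmod θ hsurj

/-! ### Degrees of Weil elements -/

/-- **`f_K ∣ deg w` for `w ∈ W_K`.** [cite: NeukirchANT1999, Ch. IV §4] -/
theorem fDeg_dvd_degZ {w : WeilGroup F} (hw : w ∈ fieldSubgroup F K) :
    (fDeg F K : ℤ) ∣ degZ (degHom F) w := by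
  rw [degZ_degHom]
  exact inertiaDeg_dvd_deg_of_mem_fieldSubgroup F K hw

/-- **The Frobenius of `K`**: an element of `W_K` of degree `f_K`. [cite: NeukirchANT1999, Ch. IV §4] -/
theorem exists_degZ_eq_fDeg (hKs : K ≤ sepClosure F) :
    ∃ w ∈ fieldSubgroup F K, degZ (degHom F) w = fDeg F K := by
  obtain ⟨w, hw, h⟩ := exists_mem_fieldSubgroup_deg_eq_inertiaDeg F K hKs
  exact ⟨w, hw, by rw [degZ_degHom, h]; rfl⟩

/-! ### The unramified levels `K_m = K F_m` -/

/-- **`K_m = K F_m`**, the compositum with the unramified level of `F` of degree `m`.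
[cite: SerreLocalFields1979, XIII §3] -/
def unrLevel (m : ℕ) : IntermediateField F (AlgebraicClosure F) := K ⊔ unramifiedLevel F m

omit [FiniteDimensional F K] in
/-- `K ≤ K_m`. [folklore] -/
theorem le_unrLevel (m : ℕ) : K ≤ unrLevel F K m := le_sup_left

omit [FiniteDimensional F K] in
/-- `K_m ⊆ F^sep`. [folklore] -/
theorem unrLevel_le_sepClosure (hKs : K ≤ sepClosure F) {m : ℕ} (hm : 0 < m) :
    unrLevel F K m ≤ sepClosure F :=
  sup_le hKs (unramifiedLevel_le_sepClosure F hm)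

/-- `K_m/F` is finite. [folklore] -/
theorem finiteDimensional_unrLevel {m : ℕ} (hm : 0 < m) : FiniteDimensional F (unrLevel F K m) := by
  haveI := (unramifiedLevel_finite_abelian_unramified F hm).1
  exact IntermediateField.finiteDimensional_sup K _

omit [FiniteDimensional F K] in
/-- **`W_{K_m} = W_K ∩ deg⁻¹(mℤ)`.** [cite: NeukirchANT1999, Ch. IV §4] -/
theorem fieldSubgroup_unrLevel {m : ℕ} (hm : 0 < m) :
    fieldSubgroup F (unrLevel F K m) = fieldSubgroup F K ⊓ degMultiples (degHom F) m := by
  rw [unrLevel, fieldSubgroup_sup, fieldSubgroup_unramifiedLevel F hm]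

omit [FiniteDimensional F K] in
/-- Membership in `W_{K_m}`. [folklore] -/
theorem mem_fieldSubgroup_unrLevel_iff {m : ℕ} (hm : 0 < m) {w : WeilGroup F} :
    w ∈ fieldSubgroup F (unrLevel F K m) ↔ w ∈ fieldSubgroup F K ∧ (m : ℤ) ∣ degZ (degHom F) w := by
  rw [fieldSubgroup_unrLevel F K hm, Subgroup.mem_inf, mem_degMultiples_iff]

omit [FiniteDimensional F K] in
/-- `W_K` normalises `W_{K_m}` (`deg` is a class function). [folklore] -/
theorem le_normalizer_fieldSubgroup_unrLevel {m : ℕ} (hm : 0 < m) :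
    fieldSubgroup F K ≤ Subgroup.normalizer
      ((fieldSubgroup F (unrLevel F K m) : Subgroup (WeilGroup F)) : Set (WeilGroup F)) := by
  intro w hw
  rw [Subgroup.mem_set_normalizer_iff]
  intro x
  rw [SetLike.mem_coe, SetLike.mem_coe, mem_fieldSubgroup_unrLevel_iff F K hm,
    mem_fieldSubgroup_unrLevel_iff F K hm]
  have hdeg : degZ (degHom F) (w * x * w⁻¹) = degZ (degHom F) x := by
    simp only [degZ, map_mul, map_inv, toAdd_mul, toAdd_inv]
    abel
  rw [hdeg]
  constructor
  · rintro ⟨hx, hd⟩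
    exact ⟨mul_mem (mul_mem hw hx) (inv_mem hw), hd⟩
  · rintro ⟨hx, hd⟩
    refine ⟨?_, hd⟩
    have h := mul_mem (mul_mem (inv_mem hw) hx) hw
    rwa [← mul_assoc, ← mul_assoc, inv_mul_cancel, one_mul, mul_assoc, inv_mul_cancel, mul_one] at h

/-- **`K_m/K` is Galois.** [cite: NeukirchANT1999, Ch. IV §4] -/
theorem isGalois_unrLevel (hKs : K ≤ sepClosure F) {m : ℕ} (hm : 0 < m) :
    letI := towerAlgebra (le_unrLevel F K m)
    IsGalois K (unrLevel F K m) := by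
  haveI := finiteDimensional_unrLevel F K hm
  exact (isGalois_of_le_normalizer F (le_unrLevel F K m) (unrLevel_le_sepClosure F K hKs hm)
    (le_normalizer_fieldSubgroup_unrLevel F K hm)).1

/-- Every `τ ∈ W_K` is `≡ σ^k (mod W_{K_m})` for `σ` a Frobenius of `K` and `f_K ∣ m`. [folklore] -/
theorem exists_zpow_inv_mul_mem_unrLevel {m : ℕ} (hm : 0 < m)
    {σ : WeilGroup F} (hσ : σ ∈ fieldSubgroup F K) (hσd : degZ (degHom F) σ = fDeg F K)
    {τ : WeilGroup F} (hτ : τ ∈ fieldSubgroup F K) :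
    ∃ k : ℤ, (σ ^ k)⁻¹ * τ ∈ fieldSubgroup F (unrLevel F K m) := by
  obtain ⟨k, hk⟩ := fDeg_dvd_degZ F K hτ
  refine ⟨k, ?_⟩
  rw [mem_fieldSubgroup_unrLevel_iff F K hm]
  refine ⟨mul_mem (inv_mem (zpow_mem hσ k)) hτ, ?_⟩
  have hdeg : degZ (degHom F) ((σ ^ k)⁻¹ * τ) = 0 := by
    simp only [degZ, map_mul, map_inv, map_zpow, toAdd_mul, toAdd_inv, toAdd_zpow] at hσd hk ⊢
    rw [hk, hσd, smul_eq_mul, mul_comm]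
    abel
  rw [hdeg]
  exact dvd_zero _

/-- **`Gal(K_m/K)` is cyclic**, generated by the Frobenius of `K`.
[cite: NeukirchANT1999, Ch. IV §4; SerreLocalFields1979, XIII §3] -/
theorem isCyclic_gal_unrLevel (hKs : K ≤ sepClosure F) {m : ℕ} (hm : 0 < m) :
    letI := towerAlgebra (le_unrLevel F K m)
    IsCyclic (unrLevel F K m ≃ₐ[K] unrLevel F K m) := by
  letI := towerAlgebra (le_unrLevel F K m)
  haveI := finiteDimensional_unrLevel F K hm
  obtain ⟨σ, hσ, hσd⟩ := exists_degZ_eq_fDeg F K hKs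
  exact ⟨⟨_, forall_mem_zpowers_relRestrict F (le_unrLevel F K m) (unrLevel_le_sepClosure F K hKs hm)
    (le_normalizer_fieldSubgroup_unrLevel F K hm) hσ
    fun τ hτ => exists_zpow_inv_mul_mem_unrLevel F K hm hσ hσd hτ⟩⟩

/-- **`(W_K : W_{K_m}) = m / f_K`** for `f_K ∣ m`: `W_K/W_{K_m} ≅ f_K ℤ / m ℤ` through
`w ↦ deg(w)/f_K (mod m/f_K)`. [cite: NeukirchANT1999, Ch. IV §4] -/
theorem relIndex_fieldSubgroup_unrLevel (hKs : K ≤ sepClosure F) {m : ℕ} (hm : 0 < m)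
    (hfm : fDeg F K ∣ m) :
    (fieldSubgroup F (unrLevel F K m)).relIndex (fieldSubgroup F K) = m / fDeg F K := by
  obtain ⟨d, hd⟩ := hfm
  have hf := fDeg_pos F K
  have hd0 : 0 < d := Nat.pos_of_mul_pos_left (hd ▸ hm)
  haveI : NeZero d := ⟨hd0.ne'⟩
  have hdiv : m / fDeg F K = d := by rw [hd, Nat.mul_div_cancel_left _ hf]
  -- the homomorphism `w ↦ deg(w)/f mod d` on `W_K`
  let θ : fieldSubgroup F K →* Multiplicative (ZMod d) :=
    { toFun := fun w => Multiplicative.ofAdd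
        (((degZ (degHom F) (w : WeilGroup F) / fDeg F K : ℤ) : ZMod d))
      map_one' := by
        simp only [OneMemClass.coe_one, degZ, map_one, toAdd_one, Int.zero_ediv, Int.cast_zero]
        rfl
      map_mul' := fun a b => by
        rw [← ofAdd_add, ← Int.cast_add, Subgroup.coe_mul]
        simp only [degZ, map_mul, toAdd_mul]
        rw [Int.add_ediv_of_dvd_left (fDeg_dvd_degZ F K a.2)] }
  have hker : θ.ker = (fieldSubgroup F (unrLevel F K m)).subgroupOf (fieldSubgroup F K) := by
    ext w
    rw [MonoidHom.mem_ker, Subgroup.mem_subgroupOf, mem_fieldSubgroup_unrLevel_iff F K hm]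
    change Multiplicative.ofAdd _ = Multiplicative.ofAdd 0 ↔ _
    rw [Multiplicative.ofAdd.injective.eq_iff, ZMod.intCast_zmod_eq_zero_iff_dvd]
    obtain ⟨c, hc⟩ := fDeg_dvd_degZ F K w.2
    rw [hc, Int.mul_ediv_cancel_left _ (by exact_mod_cast hf.ne'), hd, Nat.cast_mul]
    rw [mul_dvd_mul_iff_left (by exact_mod_cast hf.ne' : (fDeg F K : ℤ) ≠ 0)]
    exact ⟨fun h => ⟨w.2, h⟩, fun h => h.2⟩
  have hsurj : Function.Surjective θ := by
    obtain ⟨σ, hσ, hσd⟩ := exists_degZ_eq_fDeg F K hKs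
    intro x
    refine ⟨⟨σ, hσ⟩ ^ (Multiplicative.toAdd x).val, ?_⟩
    rw [map_pow]
    change Multiplicative.ofAdd (((degZ (degHom F) σ / fDeg F K : ℤ) : ZMod d)) ^ _ = x
    rw [hσd, Int.ediv_self (by exact_mod_cast hf.ne'), Int.cast_one, ← ofAdd_nsmul, nsmul_one,
      ZMod.natCast_zmod_val]
    rfl
  rw [Subgroup.relIndex, ← hker, hdiv]
  exact Subgroup.index_ker_of_surjective_zmod θ hsurj

/-- **`[K_m : K] = m / f_K`** for `f_K ∣ m`. [cite: SerreLocalFields1979, XIII §3] -/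
theorem finrank_unrLevel (hKs : K ≤ sepClosure F) {m : ℕ} (hm : 0 < m) (hfm : fDeg F K ∣ m) :
    letI := towerAlgebra (le_unrLevel F K m)
    Module.finrank K (unrLevel F K m) = m / fDeg F K := by
  haveI := finiteDimensional_unrLevel F K hm
  have h := relIndex_fieldSubgroup_eq_finrank F (le_unrLevel F K m) (unrLevel_le_sepClosure F K hKs hm)
  rw [relIndex_fieldSubgroup_unrLevel F K hKs hm hfm] at h
  exact h.symm

/-- **`f_{K_m} = m`** for `f_K ∣ m`: the degrees of `W_{K_m} = W_K ∩ deg⁻¹(mℤ)` are the multiples of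
`m` (`f_K ℤ ∩ m ℤ = m ℤ`), and `m` is attained by a power of the Frobenius of `K`.
[cite: NeukirchANT1999, Ch. IV §4] -/
theorem fDeg_unrLevel (hKs : K ≤ sepClosure F) {m : ℕ} (hm : 0 < m) (hfm : fDeg F K ∣ m) :
    letI := finiteDimensional_unrLevel F K hm
    fDeg F (unrLevel F K m) = m := by
  haveI := finiteDimensional_unrLevel F K hm
  obtain ⟨d, hd⟩ := hfm
  obtain ⟨σ, hσ, hσd⟩ := exists_degZ_eq_fDeg F K hKs
  -- `σ ^ d ∈ W_{K_m}` has degree `m`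
  have hσdm : degZ (degHom F) (σ ^ d) = m := by
    simp only [degZ, map_pow, toAdd_pow] at hσd ⊢
    rw [hσd, hd, Nat.cast_mul, nsmul_eq_mul, mul_comm]
  have hmem : m ∈ {n : ℕ | 0 < n ∧ ∃ τ ∈ fieldSubgroup F (unrLevel F K m), degZ (degHom F) τ = n} := by
    refine ⟨hm, σ ^ d, ?_, hσdm⟩
    rw [mem_fieldSubgroup_unrLevel_iff F K hm, hσdm]
    exact ⟨pow_mem hσ d, dvd_rfl⟩
  rw [fDeg, ← inertiaDeg_fieldSubgroup_eq F (unrLevel F K m) (unrLevel_le_sepClosure F K hKs hm)]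
  unfold AbstractCFT.inertiaDeg
  apply le_antisymm (Nat.sInf_le hmem)
  refine le_csInf ⟨_, hmem⟩ ?_
  rintro n ⟨hn, τ, hτ, hτn⟩
  rw [mem_fieldSubgroup_unrLevel_iff F K hm, hτn, Int.natCast_dvd_natCast] at hτ
  exact Nat.le_of_dvd hn hτ.2

/-! ### The norm group of `K_m/K` -/

/-- **`m ∣ t_K(N_{K_m/K} b)`** (`f_K ∣ m`): `t_K ∘ N_{K_m/K} = t_{K_m}` (transitivity of the norm) takes
values in `f_{K_m} ℤ = m ℤ`. [cite: SerreLocalFields1979, V §2] -/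
theorem dvd_tVal_norm_unrLevel (hKs : K ≤ sepClosure F) {m : ℕ} (hm : 0 < m) (hfm : fDeg F K ∣ m)
    (b : unrLevel F K m) (hb : b ≠ 0) :
    letI := towerAlgebra (le_unrLevel F K m)
    (m : ℤ) ∣ tVal F K (Algebra.norm K b) := by
  letI := towerAlgebra (le_unrLevel F K m)
  haveI := finiteDimensional_unrLevel F K hm
  haveI := towerAlgebra_isScalarTower_bot (F := F) (le_unrLevel F K m)
  haveI := towerAlgebra_finiteDimensional (F := F) (le_unrLevel F K m)
  haveI : Module.Free K (unrLevel F K m) := Module.Free.of_divisionRing K _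
  have h := fDeg_dvd_tVal F (unrLevel F K m) (unrLevel_le_sepClosure F K hKs hm) hb
  rw [fDeg_unrLevel F K hKs hm hfm] at h
  unfold tVal at h ⊢
  rwa [Algebra.norm_norm]

/-- **The norm group of `K_m/K` is `{u ∈ Kˣ : m ∣ t_K(u)}`** (`f_K ∣ m`): it is contained in it
(`dvd_tVal_norm_unrLevel`) and both have index `m / f_K = [K_m : K]` in `Kˣ` (the class field
axiom `cyclicNormIndexEq_holds` for the cyclic extension `K_m/K`, and `index_tDvd`).  In particular
the units of `K` are norms from `K_m`. [cite: SerreLocalFields1979, V §2 Cor. to Prop. 3, XIII §4] -/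
theorem range_unitsMap_norm_unrLevel (hKs : K ≤ sepClosure F) {m : ℕ} (hm : 0 < m)
    (hfm : fDeg F K ∣ m) :
    letI := towerAlgebra (le_unrLevel F K m)
    (Units.map (Algebra.norm K : unrLevel F K m →* K)).range = tDvd F K m := by
  letI := towerAlgebra (le_unrLevel F K m)
  haveI := finiteDimensional_unrLevel F K hm
  haveI := isGalois_unrLevel F K hKs hm
  haveI := isCyclic_gal_unrLevel F K hKs hm
  have hle : (Units.map (Algebra.norm K : unrLevel F K m →* K)).range ≤ tDvd F K m := by
    rintro _ ⟨b, rfl⟩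
    exact dvd_tVal_norm_unrLevel F K hKs hm hfm (b : unrLevel F K m) b.ne_zero
  have hN := cyclicNormIndexEq_holds F K (unrLevel F K m) (le_unrLevel F K m)
    (unrLevel_le_sepClosure F K hKs hm)
  have hf := fDeg_pos F K
  have hd0 : m / fDeg F K ≠ 0 := (Nat.div_pos (Nat.le_of_dvd hm hfm) hf).ne'
  refine Subgroup.eq_of_le_of_index_eq hle ?_ ?_
  · rw [index_tDvd F K hKs hm hfm]
    exact hd0
  · rw [index_tDvd F K hKs hm hfm, hN, finrank_unrLevel F K hKs hm hfm]

/-- **An element of `Kˣ` with `m ∣ t_K` is a norm from `K_m`** (`f_K ∣ m`); e.g. a unit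
(`t_K = 0`). [cite: SerreLocalFields1979, V §2 Cor. to Prop. 3] -/
theorem exists_norm_eq_of_dvd_tVal (hKs : K ≤ sepClosure F) {m : ℕ} (hm : 0 < m)
    (hfm : fDeg F K ∣ m) (u : Kˣ) (hu : (m : ℤ) ∣ tVal F K (u : K)) :
    letI := towerAlgebra (le_unrLevel F K m)
    ∃ b : (unrLevel F K m)ˣ, Units.map (Algebra.norm K : unrLevel F K m →* K) b = u := by
  have h : u ∈ tDvd F K m := hu
  rw [← range_unitsMap_norm_unrLevel F K hKs hm hfm] at h
  exact h

/-! ### Towers `K ≤ L` -/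

variable {L : IntermediateField F (AlgebraicClosure F)} [FiniteDimensional F L]

omit [FiniteDimensional F L] in
/-- **`t_L(a) = [L : K] t_K(a)`** for `a ∈ K` (`N_{L/F} a = (N_{K/F} a)^{[L:K]}`).
[cite: SerreLocalFields1979, Ch. II §2] -/
theorem tVal_algebraMap (hKL : K ≤ L) {a : K} (ha : a ≠ 0) :
    letI := towerAlgebra hKL
    tVal F L (algebraMap K L a) = Module.finrank K L * tVal F K a := by
  letI := towerAlgebra hKL
  haveI := towerAlgebra_isScalarTower_bot (F := F) hKL
  haveI : Module.Free K L := Module.Free.of_divisionRing K _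
  unfold tVal
  rw [← Algebra.norm_norm (S := K) (a := algebraMap K L a), Algebra.norm_algebraMap, map_pow,
    ord_pow F (Algebra.norm_ne_zero_iff.2 ha)]

/-- **`f_L ∣ [L : K] f_K`.** [cite: SerreLocalFields1979, Ch. I §4 Prop. 10] -/
theorem fDeg_dvd_finrank_mul_fDeg (hKL : K ≤ L) (hKs : K ≤ sepClosure F) (hLs : L ≤ sepClosure F) :
    letI := towerAlgebra hKL
    (fDeg F L : ℤ) ∣ Module.finrank K L * fDeg F K := by
  letI := towerAlgebra hKL
  obtain ⟨a, ha, hta⟩ := exists_tVal_eq_fDeg F K hKs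
  have h := fDeg_dvd_tVal F L hLs ((map_ne_zero_iff _ (algebraMap K L).injective).2 ha)
  rwa [tVal_algebraMap F K hKL ha, hta] at h

/-- **`e(L/K)`**, defined by `e f_L = [L : K] f_K`. [cite: SerreLocalFields1979, Ch. I §4 Prop. 10] -/
def eRel (hKL : K ≤ L) : ℕ :=
  letI := towerAlgebra hKL
  Module.finrank K L * fDeg F K / fDeg F L

/-- `e f_L = [L : K] f_K`. [folklore] -/
theorem eRel_mul_fDeg (hKL : K ≤ L) (hKs : K ≤ sepClosure F) (hLs : L ≤ sepClosure F) :
    letI := towerAlgebra hKL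
    eRel F K hKL * fDeg F L = Module.finrank K L * fDeg F K := by
  have h := fDeg_dvd_finrank_mul_fDeg F K hKL hKs hLs
  rw [← Nat.cast_mul, Int.natCast_dvd_natCast] at h
  exact Nat.div_mul_cancel h

/-- **A uniformiser of `K` is `w · π_L^e` in `L` with `w` a unit**: for `a ∈ K` with `t_K(a) = f_K`
and `π ∈ L` with `t_L(π) = f_L`, `a = w π^e` with `t_L(w) = 0`, `e = e(L/K)`.
[cite: SerreLocalFields1979, Ch. I §4] -/
theorem exists_eq_mul_pow_of_tVal_eq (hKL : K ≤ L) (hKs : K ≤ sepClosure F) (hLs : L ≤ sepClosure F)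
    {a : K} (ha : a ≠ 0) (hta : tVal F K a = fDeg F K) {π : L} (hπ : π ≠ 0)
    (htπ : tVal F L π = fDeg F L) :
    letI := towerAlgebra hKL
    ∃ w : L, w ≠ 0 ∧ tVal F L w = 0 ∧ algebraMap K L a = w * π ^ eRel F K hKL := by
  letI := towerAlgebra hKL
  have ha' : algebraMap K L a ≠ 0 := (map_ne_zero_iff _ (algebraMap K L).injective).2 ha
  have hπe : π ^ eRel F K hKL ≠ 0 := pow_ne_zero _ hπ
  refine ⟨algebraMap K L a / π ^ eRel F K hKL, div_ne_zero ha' hπe, ?_, (div_mul_cancel₀ _ hπe).symm⟩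
  rw [tVal_div F L ha' hπe, tVal_pow F L hπ, tVal_algebraMap F K hKL ha, hta, htπ, sub_eq_zero,
    ← Nat.cast_mul, ← Nat.cast_mul, ← eRel_mul_fDeg F K hKL hKs hLs]

end Local

end LocalWeilDatum

end Literature.NumberTheory.GaloisRepresentations

end
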